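import Mathlib.Tactic.LinearCombination
import Mathlib.Tactic.FieldSimp
import Mathlib.Data.Complex.Basic

/-!
# Route PrincipalMinorColouring, item `ExcessRankUnbounded` (stmt-ValiantsHypothesis-3783) —
part 2/4: the algebraic core

Pure field identities (over `ℂ`) behind the impossibility of a principal-minor representation
of `per_n(x + J)` that is injective on a `3 × 3` sub-board (`n ≥ 3`). Writing `a` for the common
diagonal value of `K` on the sub-board, `a²` resp. `v = a² - b` for the product `K(e,e')K(e',e)`
of an attacking resp. non-attacking pair of cells, the vanishing of the `3 × 3` principal minors
on non-transversal triples gives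

* `comp_of_minors`: composition rules `K(e₁,e₂)K(e₂,e₃) = a K(e₁,e₃)` along an attacking pair
  `e₁ ~ e₂` when the third cell is of the same type w.r.t. both (collinear, or free);
* `L_of_minors`: for an L-shape the two 3-cycle products have sum `a³ + a v` and product `a⁴ v`;
* `core_false`: on the seven cells `A=(1,1), B=(1,2), C=(1,3), D=(2,1), E=(2,2), F=(3,1),
  G=(3,3)` these rules are contradictory as soon as `a ≠ 0`, `v ≠ 0`, `v ≠ a²` — the chain
  `q₁ = q₂`, `p₂ = p₃`, `p₁ = q₃` through the L-shapes `(A;B,D)`, `(A;B,F)`, `(D;E,F)` forces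
  `p₃ = q₃`, i.e. a double root of `z² - (a³ + a v) z + a⁴ v`, i.e. `(a² - v)² = 0`.

This is a gauge-free rendering of the `r = 1` obstruction (Ikenmeyer–Landsberg 2017, Thm. 2.9:
`per_m`, `m ≥ 3`, has no rank-one determinantal expression); the `2 × 2` permanent escapes it
because it has only two rows.
-/

set_option linter.dupNamespace false

namespace Summit.ValiantsHypothesis.ValiantsHypothesis.Theorems.PrincipalMinorColouring

/-- **Algebraic core.** Entries `kXY = K(X,Y)` of a matrix indexed by the seven cells
`A=(1,1), B=(1,2), C=(1,3), D=(2,1), E=(2,2), F=(3,1), G=(3,3)` of a `3 × 3` board cannot satisfy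
the composition identities (E1)–(E11) forced by the order-`3` principal minors through collinear
and "two-in-a-line plus a free cell" triples (the four (E5·) give the rectangle identity
`kAD kDE = kAB kBE`), the pair identities (P1), (P2), and the L-shape identities
(L1)–(L3), when `a ≠ 0`, `v ≠ 0` and `v ≠ a²`: chaining them forces the L-shape `(D;E,F)` to have equal
3-cycle products `p₃ = q₃`, while `p₃ + q₃ = a³ + av`, `p₃ q₃ = a⁴ v` has no double root. [folklore] -/
theorem core_false {F : Type*} [Field F]
    {a v kAB kBA kAC kCB kAD kDA kAE kAF kFA kAG kBD kDB kBE kBF kFB kBG kCD kCE kDE kED kDF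
      kDG kFD kEF kFE kEG kGE : F}
    (ha : a ≠ 0) (hv : v ≠ 0) (hav : v ≠ a ^ 2)
    (E1 : kFD * kDB = a * kFB) (E2 : kAF * kFD = a * kAD) (E3 : kBE * kEF = a * kBF)
    (E4 : kFD * kDA = a * kFA)
    (E5a : kAD * kDG = a * kAG) (E5b : kBE * kEG = a * kBG) (E5c : kAB * kBG = a * kAG)
    (E5d : kDE * kEG = a * kDG) (P2 : kEG * kGE = v) (E6 : kFA * kAE = a * kFE)
    (E7 : kDF * kFA = a * kDA) (E8 : kAC * kCE = a * kAE) (E9 : kCE * kED = a * kCD)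
    (E10 : kAC * kCB = a * kAB) (E11 : kCB * kBD = a * kCD) (P1 : kAD * kDA = a ^ 2)
    (L1 : kAB * kBD * kDA + kAD * kDB * kBA = a ^ 3 + a * v)
    (L2 : kAB * kBF * kFA + kAF * kFB * kBA = a ^ 3 + a * v)
    (L3s : kDE * kEF * kFD + kDF * kFE * kED = a ^ 3 + a * v)
    (L3p : (kDE * kEF * kFD) * (kDF * kFE * kED) = a ^ 4 * v) : False := by
  have ha2 : a ^ 2 ≠ 0 := pow_ne_zero 2 ha
  -- rectangle identity (E5)
  have hEG : kEG ≠ 0 := fun h => hv (by rw [← P2, h, zero_mul])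
  have E5 : kAD * kDE = kAB * kBE := by
    refine mul_right_cancel₀ hEG ?_
    linear_combination kAD * E5d + a * E5a - a * E5c - kAB * E5b
  -- q₁ = q₂
  have hq : kAD * kDB * kBA = kAF * kFB * kBA := by
    refine mul_left_cancel₀ ha ?_
    linear_combination (-(kDB * kBA)) * E2 + (kAF * kBA) * E1
  -- p₂ = p₃
  have hp : kAB * kBF * kFA = kDE * kEF * kFD := by
    refine mul_left_cancel₀ ha2 ?_
    linear_combination (-(a * kAB * kBF)) * E4 + (-(kAB * kFD * kDA)) * E3
      + (-(kEF * kFD * kDA)) * E5 + (kDE * kEF * kFD) * P1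
  -- q₃ = kDA kAE kED
  have h3 : kDF * kFE * kED = kDA * kAE * kED := by
    refine mul_left_cancel₀ ha ?_
    linear_combination (-(kDF * kED)) * E6 + (kAE * kED) * E7
  -- p₁ = kAC kCD kDA
  have h4 : kAB * kBD * kDA = kAC * kCD * kDA := by
    refine mul_left_cancel₀ ha ?_
    linear_combination (-(kBD * kDA)) * E10 + (kAC * kDA) * E11
  -- kDA kAE kED = kAC kCD kDA
  have h5 : kDA * kAE * kED = kAC * kCD * kDA := by
    refine mul_left_cancel₀ ha ?_
    linear_combination (-(kDA * kED)) * E8 + (kDA * kAC) * E9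
  -- p₃ = q₃
  have hpq : kDE * kEF * kFD = kDF * kFE * kED := by
    linear_combination (-1 : F) * hp + L2 + hq - L1 + h4 - h5 - h3
  have key : a ^ 2 * (a ^ 2 - v) ^ 2 = 0 := by
    linear_combination (kDE * kEF * kFD - kDF * kFE * kED) * hpq
      - (a ^ 3 + a * v + kDE * kEF * kFD + kDF * kFE * kED) * L3s + 4 * L3p
  rcases mul_eq_zero.mp key with h | h
  · exact ha2 h
  · have h' : a ^ 2 - v = 0 := (pow_eq_zero_iff two_ne_zero).mp h
    exact hav (by linear_combination (-1 : F) * h')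


/-- **Composition along an attacking pair.** For a triple of cells `(e₁, e₂, e₃)` with `e₁ ~ e₂`
attacking and the two other pairs of the same type (`w = a²`: collinear; `w = v`: `e₃` free),
the vanishing `3 × 3` principal minor forces both 3-cycle products to equal `a w`, hence the
composition rules `K(e₁,e₂)K(e₂,e₃) = a K(e₁,e₃)` and `K(e₃,e₂)K(e₂,e₁) = a K(e₃,e₁)`.
Variables: `x = K(e₁,e₂)`, `x' = K(e₂,e₁)`, `y = K(e₂,e₃)`, `y' = K(e₃,e₂)`, `z = K(e₃,e₁)`,
`z' = K(e₁,e₃)`, diagonal `d₀ = d₁ = d₂ = a`. [folklore] -/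
theorem comp_of_minors {a w d0 d1 d2 x x' y y' z z' : ℂ}
    (hw : w ≠ 0) (h0 : d0 = a) (h1 : d1 = a) (h2 : d2 = a)
    (hx : x * x' = a ^ 2) (hy : y * y' = w) (hz : z' * z = w)
    (hdet : d0 * d1 * d2 - d0 * y * y' - x * x' * d2 + x * y * z + z' * x' * y' - z' * d1 * z = 0) :
    x * y = a * z' ∧ y' * x' = a * z := by
  rw [h0, h1, h2] at hdet
  -- p + q = 2 a w and p q = a² w², so p = q = a w
  have hs : x * y * z + z' * x' * y' = 2 * a * w := by
    linear_combination hdet + a * hy + a * hx + a * hz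
  have hp : (x * y * z) * (z' * x' * y') = a ^ 2 * w ^ 2 := by
    linear_combination (y * y' * (z' * z)) * hx + (a ^ 2 * (z' * z)) * hy + (a ^ 2 * w) * hz
  have hsq : (x * y * z - z' * x' * y') ^ 2 = 0 := by
    linear_combination (x * y * z + z' * x' * y' + 2 * a * w) * hs - 4 * hp
  have heq : x * y * z = z' * x' * y' := by
    have := (pow_eq_zero_iff two_ne_zero).mp hsq
    linear_combination this
  have hpz : x * y * z = a * w := by linear_combination (hs + heq) / 2
  have hqz : z' * x' * y' = a * w := by linear_combination (hs - heq) / 2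
  constructor
  · refine mul_right_cancel₀ (b := z) (fun h => hw ?_) ?_
    · rw [← hz, h, mul_zero]
    · linear_combination hpz - a * hz
  · refine mul_left_cancel₀ (a := z') (fun h => hw ?_) ?_
    · rw [← hz, h, zero_mul]
    · linear_combination hqz - a * hz

/-- **L-shape.** For a triple `(e₁, e₂, e₃)` with corner `e₁` attacking both `e₂` and `e₃` and
`e₂, e₃` non-attacking (`K(e₂,e₃)K(e₃,e₂) = v`), the vanishing `3 × 3` principal minor gives
`p + q = a³ + a v` and `p q = a⁴ v` for the two 3-cycle products `p = x y z`, `q = z' y' x'`.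
[folklore] -/
theorem L_of_minors {a v d0 d1 d2 x x' y y' z z' : ℂ}
    (h0 : d0 = a) (h1 : d1 = a) (h2 : d2 = a)
    (hx : x * x' = a ^ 2) (hy : y * y' = v) (hz : z' * z = a ^ 2)
    (hdet : d0 * d1 * d2 - d0 * y * y' - x * x' * d2 + x * y * z + z' * x' * y' - z' * d1 * z = 0) :
    x * y * z + z' * y' * x' = a ^ 3 + a * v ∧ (x * y * z) * (z' * y' * x') = a ^ 4 * v := by
  rw [h0, h1, h2] at hdet
  constructor
  · linear_combination hdet + a * hy + a * hx + a * hz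
  · linear_combination (y * y' * (z' * z)) * hx + (a ^ 2 * (z' * z)) * hy + (a ^ 2 * v) * hz

end Summit.ValiantsHypothesis.ValiantsHypothesis.Theorems.PrincipalMinorColouring
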